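import Summits.ResolutionOfSingularities.ResolutionOfSingularities.Theorems.FrobeniusLadderFInjectiveMacaulayficationKLocCellKitMod
import HarnessLib

/-!
# The EARLY-TRUNCATING product for the Fedder cell kit: truncate modulo `(Y_i^p : i ∈ S)` BEFORE each merge, not after the full product
# (crux `FInjectiveMacaulayfication` stmt-ResolutionOfSingularities-15315, chain w45a; res-L1-w45a-plan-1 ruling l.38826 «LOW, idle-only GO on the GENERIC piece: the early-truncating
# product `mulKMod` + `evalK_mulKMod_sub_mem` as a kit extension, no farm run on any bed — so that a p = 11/13 one-cell Fedder certificate is typable within the hour IF a CANONICALLY-legal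
# wild bed (ROW #10‴) appears»; kit = ✓ `KLocCellKit` / ✓ `KLocCellSound` / ✓ `KLocCellKitMod` (res-D-pv-018 as res-L1-w45a-stub-6); seat res-L1-w45a-stub-1 g17)

[OURS · L1 W4.5a] Support file (`--supports stmt-ResolutionOfSingularities-15315 --as helper`); computable list programs + soundness lemmas, in the namespace and currency of the kit;
no instance, no notation, no named fact; NOT a statement of any manuscript; nothing of the crux is proved. AI-written (AI review is weaker than expert review).

THE POINT. ✓ `KLocCellKitMod.powKMod` truncates modulo `J_S = (Y_i^p : i ∈ S)` only AFTER each full product `mulK G acc`; for a chart polynomial with many terms (the permissive wild bed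
of R25.19 has 40) the untruncated intermediate products are several times larger than their truncations (size model for that bed: 28 063 vs 5 908 terms at the worst step), and the
merge work of `mulK` is proportional to the untruncated size. Since `J_S` is an ideal, every shifted list `s·B` may be truncated BEFORE it is merged into the accumulator: `mulKMod`
(§1) does exactly that, `powKModE` iterates it, and `checkKModE` / `checkKsModE` are ✓ `checkKMod` / ✓ `checkKsMod` with `powKModE` in place of `powKMod` — SAME data currency
`(S, R, T, T₀)`, so generators and consumers are unchanged. SOUNDNESS (§2): `evalK (mulKMod p S A B) − evalK A · evalK B ∈ J_S` (induction on `A`, ✓ `evalK_truncKS_sub_mem` per term),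
`evalK (powKModE p S G m) − (evalK G)^m ∈ J_S`, and ★ `klocCellModE_of_check` / `klocCellsModE_of_check` / `klocCellsModE_of_check'` with the conclusion of ✓ `klocCellMod_of_check` VERBATIM
(the `hcellsMod` binder of ✓ `KLocCellMod.fedderAt_of_kLocCell_mod` / `honQuot_of_kLocCells_mod_range`), so every existing consumer applies unchanged. No bed is certified here.
[folklore; cite: Fedder1983, Prop. 1.7 (criterion, as consumed by `KLocCellMod`)]
-/

-- single-problem summit: the doubled namespace component is forced
set_option linter.dupNamespace false

namespace Summit.ResolutionOfSingularities.ResolutionOfSingularities.Theorems.FInjectiveMacaulayfication.KLocCellKit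

open MvPolynomial

variable {n : ℕ}

/-! ## §1 The list programs -/

/-- **THE EARLY-TRUNCATING PRODUCT**: as ✓ `mulK`, but every shifted list `s·B` is truncated modulo `(Y_i^p : i ∈ S)` (✓ `truncKS`) BEFORE it is merged into the accumulator, so no
intermediate list is longer than (a collected merge of) truncated lists. [folklore] -/
def mulKMod (p : ℕ) (S : Finset (Fin n)) (A B : List (ℤ × ℕ × (Fin n → ℕ))) : List (ℤ × ℕ × (Fin n → ℕ)) :=
  A.foldr (fun s acc => collectK (mergeFK (B.length + acc.length + 1) (truncKS p S (shiftK s B)) acc)) []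

/-- The truncating power built on `mulKMod` (truncation inside every product). [folklore] -/
def powKModE (p : ℕ) (S : Finset (Fin n)) (G : List (ℤ × ℕ × (Fin n → ℕ))) : ℕ → List (ℤ × ℕ × (Fin n → ℕ))
  | 0 => [(1, 0, 0)]
  | m + 1 => mulKMod p S G (powKModE p S G m)

/-- **THE ONE BOOLEAN CHECK of a truncated G2 cell, early-truncating version**: ✓ `checkKMod` with `powKModE` in place of `powKMod` (same data `(S, R, T, T₀)`). [folklore] -/
def checkKModE (p : ℕ) (G : List (ℤ × (Fin n → ℕ))) (S : Finset (Fin n)) (R : List ((Fin n → ℕ) × List (ℤ × (Fin n → ℕ))))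
    (T : Fin n → List (ℤ × (Fin n → ℕ))) (T₀ : List (ℤ × (Fin n → ℕ))) : Bool :=
  let GK := withKey (normL G)
  let gs := splitK p (powKModE p S GK (p - 1))
  pwDistinct (gs.map fun g => g.1) && (cofactorNFK p GK S gs R T T₀).all fun t => decide ((p : ℤ) ∣ t.1)

/-- All cells of one chart, early-truncating version (currency of ✓ `checkKsMod`). [folklore] -/
def checkKsModE (p : ℕ) (G : List (ℤ × (Fin n → ℕ)))
    (cells : List (Finset (Fin n) × List ((Fin n → ℕ) × List (ℤ × (Fin n → ℕ))) × (Fin n → List (ℤ × (Fin n → ℕ))) ×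
      List (ℤ × (Fin n → ℕ)))) : Bool :=
  cells.all fun c => checkKModE p G c.1 c.2.1 c.2.2.1 c.2.2.2

/-! ## §2 Soundness -/

variable (K : Type) [Field K]

/-- **The early-truncating product is sound modulo the ideal**: `evalK (mulKMod p S A B) − evalK A · evalK B ∈ Ideal.span ((fun i => X i ^ p) '' S)`. [folklore] -/
theorem evalK_mulKMod_sub_mem (p : ℕ) (S : Finset (Fin n)) (A B : List (ℤ × ℕ × (Fin n → ℕ))) :
    evalK K (mulKMod p S A B) - evalK K A * evalK K B ∈
      Ideal.span ((fun i : Fin n => (MvPolynomial.X i : MvPolynomial (Fin n) K) ^ p) '' (S : Set (Fin n))) := by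
  induction A with
  | nil =>
    simp only [mulKMod, List.foldr_nil, evalK_nil, zero_mul, sub_zero]
    exact Ideal.zero_mem _
  | cons s A ih =>
    simp only [mulKMod, List.foldr_cons] at ih ⊢
    rw [evalK_collectK, evalK_mergeFK, evalK_cons, add_mul]
    have h1 := evalK_truncKS_sub_mem K p S (shiftK s B)
    rw [evalK_shiftK] at h1
    have h2 := Ideal.add_mem _ h1 ih
    convert h2 using 1
    ring

/-- **The early-truncating power is sound modulo the ideal**: `evalK (powKModE p S G m) − (evalK G)^m ∈ Ideal.span ((fun i => X i ^ p) '' S)`. [folklore] -/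
theorem evalK_powKModE_sub_mem (p : ℕ) (S : Finset (Fin n)) (G : List (ℤ × ℕ × (Fin n → ℕ))) :
    ∀ m : ℕ, evalK K (powKModE p S G m) - evalK K G ^ m ∈
      Ideal.span ((fun i : Fin n => (MvPolynomial.X i : MvPolynomial (Fin n) K) ^ p) '' (S : Set (Fin n)))
  | 0 => by
    rw [powKModE, evalK_cons, evalK_nil, add_zero, pow_zero, Int.cast_one, monomial_symm_zero K, sub_self]
    exact Ideal.zero_mem _
  | m + 1 => by
    have h1 := evalK_mulKMod_sub_mem K p S G (powKModE p S G m)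
    have h2 : evalK K G * evalK K (powKModE p S G m) - evalK K G ^ (m + 1) ∈
        Ideal.span ((fun i : Fin n => (MvPolynomial.X i : MvPolynomial (Fin n) K) ^ p) '' (S : Set (Fin n))) := by
      rw [pow_succ', ← mul_sub]
      exact Ideal.mul_mem_left _ _ (evalK_powKModE_sub_mem p S G m)
    have h3 := Ideal.add_mem _ h1 h2
    rw [sub_add_sub_cancel] at h3
    rw [powKModE]
    exact h3

/-- ★ **THE TRUNCATED G2 CELL FROM ONE KERNEL CHECK (early-truncating power)**: if `checkKModE p G S R T T₀ = true`, the weakened per-stratum binder of ✓ `KLocCellMod` (§2′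
`fedderAt_of_kLocCell_mod`) holds VERBATIM — same statement as ✓ `klocCellMod_of_check`. [folklore] -/
theorem klocCellModE_of_check (p : ℕ) [Fact p.Prime] [CharP K p] (G : List (ℤ × (Fin n → ℕ))) (S : Finset (Fin n))
    (R : List ((Fin n → ℕ) × List (ℤ × (Fin n → ℕ)))) (T : Fin n → List (ℤ × (Fin n → ℕ))) (T₀ : List (ℤ × (Fin n → ℕ)))
    (hcheck : checkKModE p G S R T T₀ = true) :
    ∃ (L : List ((Fin n →₀ ℕ) × MvPolynomial (Fin n) K)) (rr : List (MvPolynomial (Fin n) K))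
      (t : Fin n → MvPolynomial (Fin n) K) (t₀ : MvPolynomial (Fin n) K),
      (L.map Prod.fst).Nodup ∧ (∀ e ∈ L, ∀ i : Fin n, e.1 i < p) ∧
      evalL K G ^ (p - 1) - (L.map fun e => MvPolynomial.monomial e.1 (1 : K) * MvPolynomial.expand p e.2).sum ∈
        Ideal.span ((fun i : Fin n => (MvPolynomial.X i : MvPolynomial (Fin n) K) ^ p) '' (S : Set (Fin n))) ∧
      (1 : MvPolynomial (Fin n) K) = (List.zipWith (fun r e => r * MvPolynomial.expand p e.2) rr L).sum +
        ∑ i ∈ S, t i * MvPolynomial.X i + t₀ * evalL K G := by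
  have hp : 0 < p := (Fact.out : p.Prime).pos
  simp only [checkKModE, Bool.and_eq_true, List.all_eq_true, decide_eq_true_eq] at hcheck
  obtain ⟨hkeys, hcof⟩ := hcheck
  have hGK : evalK K (withKey (normL G)) = evalL K G := by rw [evalK_withKey, evalL_normL]
  refine ⟨(splitK p (powKModE p S (withKey (normL G)) (p - 1))).map fun g => (Finsupp.equivFunOnFinite.symm g.2.1, evalK K g.2.2),
    (splitK p (powKModE p S (withKey (normL G)) (p - 1))).map fun g => evalK K (lookupRK R g.1 g.2.1), fun i => evalL K (T i),
    evalL K T₀, splitK_nodup K p hp _ (pairwise_of_pwDistinct _ hkeys), ?_, ?_, ?_⟩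
  · intro e he i
    obtain ⟨g, hg, rfl⟩ := List.mem_map.mp he
    simpa using (splitK_inv p hp _ g hg).2 i
  · rw [← evalK_splitK K p, ← hGK, ← Ideal.neg_mem_iff, neg_sub]
    exact evalK_powKModE_sub_mem K p S _ (p - 1)
  · have h := evalK_cofactorNFK K p (withKey (normL G)) S (splitK p (powKModE p S (withKey (normL G)) (p - 1))) R T T₀
    rw [evalK_eq_zero_of_dvd K p _ hcof, hGK] at h
    exact (sub_eq_zero.mp h.symm).symm

/-- ★ **ALL early-truncated cells of one chart from ONE kernel check** (`checkKsModE`): the weakened cells binder `hcellsMod` of ✓ `KLocCellMod.honQuot_of_kLocCells_mod_range`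
for `SS = cells.map Prod.fst` and `g = evalL K G` — same statement as ✓ `klocCellsMod_of_check`. [folklore] -/
theorem klocCellsModE_of_check (p : ℕ) [Fact p.Prime] [CharP K p] (G : List (ℤ × (Fin n → ℕ)))
    (cells : List (Finset (Fin n) × List ((Fin n → ℕ) × List (ℤ × (Fin n → ℕ))) × (Fin n → List (ℤ × (Fin n → ℕ))) ×
      List (ℤ × (Fin n → ℕ))))
    (hcheck : checkKsModE p G cells = true) :
    ∀ S ∈ cells.map Prod.fst, ∃ (L : List ((Fin n →₀ ℕ) × MvPolynomial (Fin n) K)) (rr : List (MvPolynomial (Fin n) K))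
      (t : Fin n → MvPolynomial (Fin n) K) (t₀ : MvPolynomial (Fin n) K),
      (L.map Prod.fst).Nodup ∧ (∀ e ∈ L, ∀ i : Fin n, e.1 i < p) ∧
      evalL K G ^ (p - 1) - (L.map fun e => MvPolynomial.monomial e.1 (1 : K) * MvPolynomial.expand p e.2).sum ∈
        Ideal.span ((fun i : Fin n => (MvPolynomial.X i : MvPolynomial (Fin n) K) ^ p) '' (S : Set (Fin n))) ∧
      (1 : MvPolynomial (Fin n) K) = (List.zipWith (fun r e => r * MvPolynomial.expand p e.2) rr L).sum +
        ∑ i ∈ S, t i * MvPolynomial.X i + t₀ * evalL K G := by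
  intro S hS
  obtain ⟨c, hc, rfl⟩ := List.mem_map.mp hS
  simp only [checkKsModE, List.all_eq_true] at hcheck
  exact klocCellModE_of_check K p G c.1 c.2.1 c.2.2.1 c.2.2.2 (hcheck c hc)

/-- Explicit-strata-list form (statement shape of the campaign files: `∀ S ∈ SS` for a literal `SS`) — same statement as ✓ `klocCellsMod_of_check'`. [folklore] -/
theorem klocCellsModE_of_check' (p : ℕ) [Fact p.Prime] [CharP K p] (G : List (ℤ × (Fin n → ℕ))) (SS : List (Finset (Fin n)))
    (cells : List (Finset (Fin n) × List ((Fin n → ℕ) × List (ℤ × (Fin n → ℕ))) × (Fin n → List (ℤ × (Fin n → ℕ))) ×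
      List (ℤ × (Fin n → ℕ))))
    (hSS : cells.map Prod.fst = SS) (hcheck : checkKsModE p G cells = true) :
    ∀ S ∈ SS, ∃ (L : List ((Fin n →₀ ℕ) × MvPolynomial (Fin n) K)) (rr : List (MvPolynomial (Fin n) K))
      (t : Fin n → MvPolynomial (Fin n) K) (t₀ : MvPolynomial (Fin n) K),
      (L.map Prod.fst).Nodup ∧ (∀ e ∈ L, ∀ i : Fin n, e.1 i < p) ∧
      evalL K G ^ (p - 1) - (L.map fun e => MvPolynomial.monomial e.1 (1 : K) * MvPolynomial.expand p e.2).sum ∈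
        Ideal.span ((fun i : Fin n => (MvPolynomial.X i : MvPolynomial (Fin n) K) ^ p) '' (S : Set (Fin n))) ∧
      (1 : MvPolynomial (Fin n) K) = (List.zipWith (fun r e => r * MvPolynomial.expand p e.2) rr L).sum +
        ∑ i ∈ S, t i * MvPolynomial.X i + t₀ * evalL K G := by
  rw [← hSS]
  exact klocCellsModE_of_check K p G cells hcheck

end Summit.ResolutionOfSingularities.ResolutionOfSingularities.Theorems.FInjectiveMacaulayfication.KLocCellKit
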